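import Literature.AlgebraicGeometry.Milne1999.ProductPolarizationClassFactors
import Literature.AlgebraicGeometry.Milne1999.HodgeGroupIsogeny
import HarnessLib

/-!
# Milne's product divisor classes are natural under product homomorphisms `f × g`, `⊕ᵢ gᵢ`, `f^{a+1}`
# (and transport along product isogenies)

Family `hodge`, lane `lit-hodgefound` (Track 2 foundations library), layer `Literature/AlgebraicGeometry/Milne1999`,
namespace `Literature.AlgebraicGeometry.Milne1999`; prover seat `lit-hodgefound-p21` (generation 36, row g36-#7), sequel
of `Milne1999/ProductPolarizationClass` (g36-#1) and `Milne1999/ProductPolarizationClassFactors` (g36-#5).  The product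
classes `prodPolarizationClass A B h_A h_B = pr_A^* h_A + pr_B^* h_B`, `sumPolarizationClass A h = Σᵢ πᵢ^* hᵢ`,
`powPolarizationClass A h a = Σᵣ prᵣ^* h` PULL BACK TO THE PRODUCT CLASSES OF THE PULLED-BACK FACTORS along
`f × g` (`AbelianVariety.prodMap`), `⊕ᵢ gᵢ` (`biproduct.map`), `f^{a+1}` (`powSuccMap`) — the computations done by hand
in `Pohlmann1968/HodgeClassesProductSpanCMProducts*` — and are therefore hard Lefschetz / polarization classes along
product isogenies exactly when the original classes are.  THEOREMS ONLY (no definition, no named fact, no instance;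
D-0026 net debt `0`).

## Sources, VERBATIM

* J. S. Milne, *Lefschetz classes on abelian varieties*, Duke Math. J. **96** (1999) [Milne1999LefschetzClasses], §1
  p. 643: «Let `A₁, …, A_s` be abelian varieties, and let `A = A₁ × ⋯ × A_s`. If `Dᵢ` is an ample divisor on `Aᵢ` for
  each `i`, then `D = Σᵢ A₁ × ⋯ × A_{i-1} × Dᵢ × A_{i+1} × ⋯ × A_s` is an ample divisor on `A`».
* D. Mumford, *Abelian Varieties* (1970) [MumfordAV1970], §19 (`Hom(C, A × B) = Hom(C, A) ⊕ Hom(C, B)`: the product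
  homomorphism `f × g` and its components `(f × g) ≫ pr = pr ≫ f`), §7 Application 3 (isogenies).
* H. Lange, *Abelian Varieties over the Complex Numbers* (2023) [Lange2023AbelianVarietiesComplex], §2.1.1 p. 68 (the
  induced polarization `f^* L` along an isogeny).
* B. van Geemen, *An introduction to the Hodge conjecture for abelian varieties*, LNM 1594 (1994) [vanGeemen1994HodgeAV],
  3.6 (an isogeny induces an isomorphism on `H•(·, ℚ)`).
* A. Hatcher, *Algebraic Topology* (2002) [HatcherAT2002], §3.2 Thm. 3.16 (naturality of the Künneth/cross structure:
  `(f × g)^* pr^* = pr^* f^*`).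
* Ch. Birkenhake, H. Lange, *Complex Abelian Varieties* (1992) [LangeBirkenhake1992], §5.3 (the product polarization
  `p₁^* L₁ ⊗ ⋯ ⊗ p_s^* L_s` restricts to `Lᵢ` on the `i`-th factor).

## WHAT IS PROVED

* §0 (schemes) `HodgeTheory.complexBetti_map_tensorHom_map_fst_add_map_snd`:
  `(f ⊗ g)^*(pr_Y^* η + pr_Z^* η') = pr_{Y'}^*(f^* η) + pr_{Z'}^*(g^* η')` in every degree.
* §1 (`A × B`) `complexBetti_map_prodMap_map_fst/snd` (`(f × g)^* pr_A^* x = pr_{A'}^* f^* x`),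
  **`complexBetti_map_prodMap_prodPolarizationClass`** (`(f × g)^* D(h_A, h_B) = D(f^* h_A, g^* h_B)`),
  `hasHardLefschetzProperty_prodPolarizationClass_map_iff_of_isIsogeny` (for isogenies `f`, `g`: `D(f^* h_A, g^* h_B)`
  is hard Lefschetz in dimension `dim (A' × B')` iff `D(h_A, h_B)` is in dimension `dim (A × B)`),
  `isPolarizationClass_prodPolarizationClass_map_of_isIsogeny` (polarization classes pull back along `f × g`).
* §2 (`⨁ᵢ Aᵢ`) `complexBetti_map_biproductMap_map_π`, **`complexBetti_map_biproductMap_sumPolarizationClass`**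
  (`(⊕ gᵢ)^*(Σ πᵢ^* hᵢ) = Σ πᵢ^*(gᵢ^* hᵢ)`), `hasHardLefschetzProperty_sumPolarizationClass_map_iff_of_isIsogeny`,
  `isPolarizationClass_sumPolarizationClass_map_of_isIsogeny`.
* §3 (`A^{a+1}`) **`powPolarizationClass_eq_sum`** (`h^{(a+1)} = Σᵣ prᵣ^* h` — the recursion of
  `powPolarizationClass` unrolled over the projections `powProj`), `complexBetti_map_powProj_powSuccMap` and
  **`complexBetti_map_powSuccMap_powPolarizationClass`** (`(f^{a+1})^* h^{(a+1)} = (f^* h)^{(a+1)}`),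
  `hasHardLefschetzProperty_powPolarizationClass_map_iff_of_isIsogeny`,
  `isPolarizationClass_powPolarizationClass_map_of_isIsogeny`.
* §4 (coordinate inclusions) **`complexBetti_map_biproductι_sumPolarizationClass`** (`ιᵢ^* (Σⱼ πⱼ^* hⱼ) = hᵢ`),
  `sumPolarizationClass_inj`, **`complexBetti_map_powPolarizationClass_of_comp_powProj`** (`ι^* h^{(a+1)} = h` for
  every coordinate inclusion `ι`), `complexBetti_map_powLift_single_powPolarizationClass`, `powPolarizationClass_inj`
  (Birkenhake–Lange §5.3: the product polarization restricts to `Lᵢ` on each factor).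

## References

* [Milne1999LefschetzClasses] J. S. Milne, Duke Math. J. 96 (1999), §1 p. 643.
* [MumfordAV1970] D. Mumford, *Abelian Varieties* (1970), §19, §7 Application 3.
* [Lange2023AbelianVarietiesComplex] H. Lange, *Abelian Varieties over the Complex Numbers* (2023), §2.1.1 p. 68.
* [vanGeemen1994HodgeAV] B. van Geemen, LNM 1594 (1994), 3.6.
* [HatcherAT2002] A. Hatcher, *Algebraic Topology* (2002), §3.2 Thm. 3.16.
* [LangeBirkenhake1992] Ch. Birkenhake, H. Lange, *Complex Abelian Varieties* (1992), §5.3.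
-/

noncomputable section

open CategoryTheory CategoryTheory.Limits MonoidalCategory CartesianMonoidalCategory
open Literature.AlgebraicTopology.SingularHomology
open Literature.AlgebraicGeometry.HodgeTheory
open Literature.AlgebraicGeometry.Motives
open Literature.Geometry.Kaehler (lefschetzPow HasHardLefschetzProperty)

/-! ### §0 Schemes: `(f ⊗ g)^*(pr_Y^* η + pr_Z^* η') = pr^*(f^* η) + pr^*(g^* η')` -/

namespace Literature.AlgebraicGeometry.HodgeTheory

/-- **Naturality of the product class**: for `f : Y' ⟶ Y`, `g : Z' ⟶ Z` over `ℂ` and classes `η ∈ Hⁱ(Y(ℂ))`,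
`η' ∈ Hⁱ(Z(ℂ))`, `(f ⊗ₘ g)^*(pr_Y^* η + pr_Z^* η') = pr_{Y'}^*(f^* η) + pr_{Z'}^*(g^* η')` (`(f ⊗ₘ g) ≫ pr_Y = pr_{Y'} ≫ f`).
[cite: HatcherAT2002, §3.2 Thm. 3.16] -/
theorem complexBetti_map_tensorHom_map_fst_add_map_snd {Y Y' Z Z' : SchemeOver ℂ} (f : Y' ⟶ Y) (g : Z' ⟶ Z)
    {i : ℕ} (η : complexBetti Y i) (η' : complexBetti Z i) :
    complexBetti.map (f ⊗ₘ g) i (complexBetti.map (fst Y Z) i η + complexBetti.map (snd Y Z) i η') =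
      complexBetti.map (fst Y' Z') i (complexBetti.map f i η) + complexBetti.map (snd Y' Z') i (complexBetti.map g i η') := by
  rw [map_add, ← CategoryTheory.comp_apply, ← complexBetti.map_comp, tensorHom_fst, complexBetti.map_comp,
    CategoryTheory.comp_apply, ← CategoryTheory.comp_apply (complexBetti.map (snd Y Z) i), ← complexBetti.map_comp,
    tensorHom_snd, complexBetti.map_comp, CategoryTheory.comp_apply]

end Literature.AlgebraicGeometry.HodgeTheory

namespace Literature.AlgebraicGeometry.Milne1999

/-- `ι^* p^* c = (ι ≫ p)^* c` for homomorphisms of abelian varieties. [folklore] -/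
private theorem map_map_eq_map_comp {P Q R : AbelianVariety ℂ} (ι : P ⟶ Q) (p : Q ⟶ R) {k : ℕ}
    (c : complexBetti R.X k) :
    complexBetti.map ι.hom.hom.hom k (complexBetti.map p.hom.hom.hom k c) = complexBetti.map (ι ≫ p).hom.hom.hom k c := by
  rw [complexBetti_map_comp_hom, ModuleCat.comp_apply]

/-! ### §1 `A × B`: `(f × g)^* (pr_A^* h_A + pr_B^* h_B) = pr_{A'}^* f^* h_A + pr_{B'}^* g^* h_B` -/

section Prod

variable {A A' B B' : AbelianVariety ℂ} (f : A' ⟶ A) (g : B' ⟶ B)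

/-- `(f × g)^* pr_A^* x = pr_{A'}^* f^* x` (`(f × g) ≫ pr_A = pr_{A'} ≫ f`). [cite: MumfordAV1970, §19]
[cite: HatcherAT2002, §3.2 Thm. 3.16] -/
theorem complexBetti_map_prodMap_map_fst {k : ℕ} (x : complexBetti A.X k) :
    complexBetti.map (AbelianVariety.prodMap f g).hom.hom.hom k (complexBetti.map (AbelianVariety.fst A B).hom.hom.hom k x) =
      complexBetti.map (AbelianVariety.fst A' B').hom.hom.hom k (complexBetti.map f.hom.hom.hom k x) := by
  rw [map_map_eq_map_comp, map_map_eq_map_comp, AbelianVariety.prodMap_fst]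

/-- `(f × g)^* pr_B^* y = pr_{B'}^* g^* y`. [cite: MumfordAV1970, §19] [cite: HatcherAT2002, §3.2 Thm. 3.16] -/
theorem complexBetti_map_prodMap_map_snd {k : ℕ} (y : complexBetti B.X k) :
    complexBetti.map (AbelianVariety.prodMap f g).hom.hom.hom k (complexBetti.map (AbelianVariety.snd A B).hom.hom.hom k y) =
      complexBetti.map (AbelianVariety.snd A' B').hom.hom.hom k (complexBetti.map g.hom.hom.hom k y) := by
  rw [map_map_eq_map_comp, map_map_eq_map_comp, AbelianVariety.prodMap_snd]

/-- **`(f × g)^* (pr_A^* h_A + pr_B^* h_B) = pr_{A'}^*(f^* h_A) + pr_{B'}^*(g^* h_B)`**: the product divisor class of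
`A × B` pulls back along `f × g : A' × B' ⟶ A × B` to the product divisor class of the pulled-back factors.
[cite: Milne1999LefschetzClasses, §1 p. 643] [cite: MumfordAV1970, §19] [cite: HatcherAT2002, §3.2 Thm. 3.16] -/
theorem complexBetti_map_prodMap_prodPolarizationClass (hA : complexBetti A.X 2) (hB : complexBetti B.X 2) :
    complexBetti.map (AbelianVariety.prodMap f g).hom.hom.hom 2 (prodPolarizationClass A B hA hB) =
      prodPolarizationClass A' B' (complexBetti.map f.hom.hom.hom 2 hA) (complexBetti.map g.hom.hom.hom 2 hB) := by
  rw [prodPolarizationClass_def, prodPolarizationClass_def, map_add, complexBetti_map_prodMap_map_fst,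
    complexBetti_map_prodMap_map_snd]

variable {f g}

/-- **Along isogenies `f`, `g`: `pr^*(f^* h_A) + pr^*(g^* h_B)` is hard Lefschetz in dimension `dim (A' × B')` iff
`pr^* h_A + pr^* h_B` is hard Lefschetz in dimension `dim (A × B)`** (`f × g` is an isogeny, along which hard
Lefschetz transports both ways). [cite: vanGeemen1994HodgeAV, 3.6 (p. 236)] [cite: MumfordAV1970, §19] -/
theorem hasHardLefschetzProperty_prodPolarizationClass_map_iff_of_isIsogeny (hf : AbelianVariety.IsIsogeny f)
    (hg : AbelianVariety.IsIsogeny g) (hA : complexBetti A.X 2) (hB : complexBetti B.X 2) :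
    HasHardLefschetzProperty (prodPolarizationClass A' B' (complexBetti.map f.hom.hom.hom 2 hA)
        (complexBetti.map g.hom.hom.hom 2 hB)) (A'.prod B').dim ↔
      HasHardLefschetzProperty (prodPolarizationClass A B hA hB) (A.prod B).dim := by
  rw [← complexBetti_map_prodMap_prodPolarizationClass,
    AbelianVariety.dim_eq_of_isIsogeny (AbelianVariety.isIsogeny_prodMap hf hg)]
  exact Deligne1982.hasHardLefschetzProperty_map_iff_of_isIsogeny (AbelianVariety.isIsogeny_prodMap hf hg) _ _

/-- **Polarization classes of product shape pull back along product isogenies**: if `pr^* h_A + pr^* h_B` is a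
polarization class of `A × B` and `f`, `g` are isogenies, then `pr^*(f^* h_A) + pr^*(g^* h_B)` is a polarization class
of `A' × B'`. [cite: Lange2023AbelianVarietiesComplex, §2.1.1 (p. 68, the induced polarization)]
[cite: Milne1999LefschetzClasses, §1 p. 643] -/
theorem isPolarizationClass_prodPolarizationClass_map_of_isIsogeny (hf : AbelianVariety.IsIsogeny f)
    (hg : AbelianVariety.IsIsogeny g) {hA : complexBetti A.X 2} {hB : complexBetti B.X 2}
    (h : IsPolarizationClass (A.prod B).dim (A.prod B).X (prodPolarizationClass A B hA hB)) :
    IsPolarizationClass (A'.prod B').dim (A'.prod B').X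
      (prodPolarizationClass A' B' (complexBetti.map f.hom.hom.hom 2 hA) (complexBetti.map g.hom.hom.hom 2 hB)) := by
  rw [← complexBetti_map_prodMap_prodPolarizationClass]
  exact h.map_of_isIsogeny' (AbelianVariety.isIsogeny_prodMap hf hg)

end Prod

/-! ### §2 `⨁ᵢ Aᵢ`: `(⊕ᵢ gᵢ)^* (Σᵢ πᵢ^* hᵢ) = Σᵢ πᵢ^* (gᵢ^* hᵢ)` -/

section Sum

variable {m : ℕ} {A A' : Fin m → AbelianVariety ℂ} (g : ∀ i, A' i ⟶ A i)

/-- `(⊕ gᵢ)^* πᵢ^* x = πᵢ^* gᵢ^* x` (`biproduct.map g ≫ πᵢ = πᵢ ≫ gᵢ`). [cite: MumfordAV1970, §19] -/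
theorem complexBetti_map_biproductMap_map_π (i : Fin m) {k : ℕ} (x : complexBetti (A i).X k) :
    complexBetti.map (biproduct.map g).hom.hom.hom k (complexBetti.map (biproduct.π A i).hom.hom.hom k x) =
      complexBetti.map (biproduct.π A' i).hom.hom.hom k (complexBetti.map (g i).hom.hom.hom k x) := by
  rw [map_map_eq_map_comp, map_map_eq_map_comp, biproduct.map_π]

/-- **`(⊕ᵢ gᵢ)^* (Σᵢ πᵢ^* hᵢ) = Σᵢ πᵢ^* (gᵢ^* hᵢ)`**: Milne's product divisor class of `⨁ Aᵢ` pulls back along the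
componentwise homomorphism `⊕ gᵢ : ⨁ A'ᵢ ⟶ ⨁ Aᵢ` to the product divisor class of the pulled-back factors.
[cite: Milne1999LefschetzClasses, §1 p. 643] [cite: MumfordAV1970, §19] -/
theorem complexBetti_map_biproductMap_sumPolarizationClass (h : ∀ i, complexBetti (A i).X 2) :
    complexBetti.map (biproduct.map g).hom.hom.hom 2 (sumPolarizationClass A h) =
      sumPolarizationClass A' fun i => complexBetti.map (g i).hom.hom.hom 2 (h i) := by
  rw [sumPolarizationClass_def, sumPolarizationClass_def, map_sum]
  exact Finset.sum_congr rfl fun i _ => complexBetti_map_biproductMap_map_π g i (h i)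

end Sum

section SumIsogeny

variable {n : ℕ} {A A' : Fin (n + 1) → AbelianVariety ℂ} {g : ∀ i, A' i ⟶ A i}

/-- **Along componentwise isogenies `gᵢ`: `Σ πᵢ^*(gᵢ^* hᵢ)` is hard Lefschetz in dimension `dim ⨁ A'ᵢ` iff
`Σ πᵢ^* hᵢ` is hard Lefschetz in dimension `dim ⨁ Aᵢ`** (`⊕ gᵢ` is an isogeny, `isIsogeny_biproduct_map`).
[cite: vanGeemen1994HodgeAV, 3.6 (p. 236)] [cite: MumfordAV1970, §19] -/
theorem hasHardLefschetzProperty_sumPolarizationClass_map_iff_of_isIsogeny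
    (hg : ∀ i, AbelianVariety.IsIsogeny (g i)) (h : ∀ i, complexBetti (A i).X 2) :
    HasHardLefschetzProperty (sumPolarizationClass A' fun i => complexBetti.map (g i).hom.hom.hom 2 (h i)) (⨁ A').dim ↔
      HasHardLefschetzProperty (sumPolarizationClass A h) (⨁ A).dim := by
  rw [← complexBetti_map_biproductMap_sumPolarizationClass,
    AbelianVariety.dim_eq_of_isIsogeny (isIsogeny_biproduct_map hg)]
  exact Deligne1982.hasHardLefschetzProperty_map_iff_of_isIsogeny (isIsogeny_biproduct_map hg) _ _

/-- **Polarization classes of product shape pull back along componentwise isogenies of finite biproducts.**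
[cite: Lange2023AbelianVarietiesComplex, §2.1.1 (p. 68)] [cite: Milne1999LefschetzClasses, §1 p. 643] -/
theorem isPolarizationClass_sumPolarizationClass_map_of_isIsogeny (hg : ∀ i, AbelianVariety.IsIsogeny (g i))
    {h : ∀ i, complexBetti (A i).X 2} (hp : IsPolarizationClass (⨁ A).dim (⨁ A).X (sumPolarizationClass A h)) :
    IsPolarizationClass (⨁ A').dim (⨁ A').X
      (sumPolarizationClass A' fun i => complexBetti.map (g i).hom.hom.hom 2 (h i)) := by
  rw [← complexBetti_map_biproductMap_sumPolarizationClass]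
  exact hp.map_of_isIsogeny' (isIsogeny_biproduct_map hg)

end SumIsogeny

/-! ### §3 `A^{a+1}`: `h^{(a+1)} = Σᵣ prᵣ^* h` and `(f^{a+1})^* h^{(a+1)} = (f^* h)^{(a+1)}` -/

section Pow

variable (A : AbelianVariety ℂ) (h : complexBetti A.X 2)

/-- **`h^{(a+1)} = Σᵣ prᵣ^* h` on `A^{a+1}`**: the recursively defined `powPolarizationClass A h a`
(`h^{(1)} = h`, `h^{(a+2)} = pr^* h^{(a+1)} + pr_A^* h`) is the sum of the pull-backs of `h` along the `a + 1`
projections `powProj A a r : A^{a+1} ⟶ A` — Milne's `D = Σᵢ A × ⋯ × Dᵢ × ⋯ × A` literally.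
[cite: Milne1999LefschetzClasses, §1 p. 643] [cite: MumfordAV1970, §19] -/
theorem powPolarizationClass_eq_sum :
    ∀ a : ℕ, powPolarizationClass A h a = ∑ r : Fin (a + 1), complexBetti.map (powProj A a r).hom.hom.hom 2 h
  | 0 => by
    rw [Fin.sum_univ_one, powProj_zero, powPolarizationClass_zero]
    change h = complexBetti.map (𝟙 A.X) 2 h
    rw [complexBetti.map_id]
    rfl
  | a + 1 => by
    rw [Fin.sum_univ_castSucc, powProj_succ_last, powPolarizationClass_succ, prodPolarizationClass_def,
      powPolarizationClass_eq_sum a, map_sum]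
    refine congrArg₂ (· + ·) (Finset.sum_congr rfl fun r _ => ?_) rfl
    rw [powProj_succ_castSucc, ← map_map_eq_map_comp]
    rfl

variable {A} {A' : AbelianVariety ℂ} (f : A' ⟶ A)

/-- `(f^{a+1})^* prᵣ^* x = prᵣ^* f^* x` (`f^{a+1} ≫ prᵣ = prᵣ ≫ f`, `powSuccMap_powProj`). [cite: MumfordAV1970, §19] -/
theorem complexBetti_map_powSuccMap_map_powProj (a : ℕ) (r : Fin (a + 1)) {k : ℕ} (x : complexBetti A.X k) :
    complexBetti.map (powSuccMap f a).hom.hom.hom k (complexBetti.map (powProj A a r).hom.hom.hom k x) =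
      complexBetti.map (powProj A' a r).hom.hom.hom k (complexBetti.map f.hom.hom.hom k x) := by
  rw [map_map_eq_map_comp, map_map_eq_map_comp, powSuccMap_powProj]

/-- **`(f^{a+1})^* h^{(a+1)} = (f^* h)^{(a+1)}`**: Milne's divisor class of the power `A^{a+1}` pulls back along the
componentwise homomorphism `f^{a+1} : A'^{a+1} ⟶ A^{a+1}` to the divisor class of `f^* h` on `A'^{a+1}`.
[cite: Milne1999LefschetzClasses, §1 p. 643] [cite: MumfordAV1970, §19] -/
theorem complexBetti_map_powSuccMap_powPolarizationClass (a : ℕ) :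
    complexBetti.map (powSuccMap f a).hom.hom.hom 2 (powPolarizationClass A h a) =
      powPolarizationClass A' (complexBetti.map f.hom.hom.hom 2 h) a := by
  rw [powPolarizationClass_eq_sum, powPolarizationClass_eq_sum, map_sum]
  exact Finset.sum_congr rfl fun r _ => complexBetti_map_powSuccMap_map_powProj f a r h

variable {f}

/-- **Along an isogeny `f`: `(f^* h)^{(a+1)}` is hard Lefschetz in dimension `dim A'^{a+1}` iff `h^{(a+1)}` is hard
Lefschetz in dimension `dim A^{a+1}`** (`f^{a+1}` is an isogeny, `isIsogeny_powSuccMap`).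
[cite: vanGeemen1994HodgeAV, 3.6 (p. 236)] [cite: MumfordAV1970, §7 Application 3 and §19] -/
theorem hasHardLefschetzProperty_powPolarizationClass_map_iff_of_isIsogeny (hf : AbelianVariety.IsIsogeny f) (a : ℕ) :
    HasHardLefschetzProperty (powPolarizationClass A' (complexBetti.map f.hom.hom.hom 2 h) a) (A'.powSucc a).dim ↔
      HasHardLefschetzProperty (powPolarizationClass A h a) (A.powSucc a).dim := by
  rw [← complexBetti_map_powSuccMap_powPolarizationClass,
    AbelianVariety.dim_eq_of_isIsogeny (isIsogeny_powSuccMap hf a)]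
  exact Deligne1982.hasHardLefschetzProperty_map_iff_of_isIsogeny (isIsogeny_powSuccMap hf a) _ _

/-- **Polarization classes of Milne's shape on powers pull back along powers of isogenies.**
[cite: Lange2023AbelianVarietiesComplex, §2.1.1 (p. 68)] [cite: Milne1999LefschetzClasses, §1 p. 643] -/
theorem isPolarizationClass_powPolarizationClass_map_of_isIsogeny (hf : AbelianVariety.IsIsogeny f) (a : ℕ)
    (hp : IsPolarizationClass (A.powSucc a).dim (A.powSucc a).X (powPolarizationClass A h a)) :
    IsPolarizationClass (A'.powSucc a).dim (A'.powSucc a).X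
      (powPolarizationClass A' (complexBetti.map f.hom.hom.hom 2 h) a) := by
  rw [← complexBetti_map_powSuccMap_powPolarizationClass]
  exact hp.map_of_isIsogeny' (isIsogeny_powSuccMap hf a)

end Pow

/-! ### §4 Restriction along the coordinate inclusions: `ιᵢ^* (Σⱼ πⱼ^* hⱼ) = hᵢ`, `ι_s^* h^{(a+1)} = h` -/

section Inclusions

/-- **`ιᵢ^* (Σⱼ πⱼ^* hⱼ) = hᵢ`**: Milne's product divisor class of `⨁ Aⱼ` restricts along the inclusion
`ιᵢ = biproduct.ι A i : Aᵢ ⟶ ⨁ Aⱼ` of a factor to `hᵢ` (`ιᵢ ≫ πᵢ = 𝟙`, `ιᵢ ≫ πⱼ = 0` for `j ≠ i`, and `0^* = 0` in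
positive degree).  (Birkenhake–Lange: the product polarization restricts to `Lᵢ` on the `i`-th factor.)
[cite: LangeBirkenhake1992, §5.3] [cite: Milne1999LefschetzClasses, §1 p. 643] [cite: MumfordAV1970, §19] -/
theorem complexBetti_map_biproductι_sumPolarizationClass {m : ℕ} (A : Fin m → AbelianVariety ℂ)
    (h : ∀ i, complexBetti (A i).X 2) (i : Fin m) :
    complexBetti.map (biproduct.ι A i).hom.hom.hom 2 (sumPolarizationClass A h) = h i := by
  rw [sumPolarizationClass_def, map_sum, Finset.sum_eq_single i]
  · rw [map_map_eq_map_comp, biproduct.ι_π_self]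
    change complexBetti.map (𝟙 (A i).X) 2 (h i) = h i
    rw [complexBetti.map_id]
    rfl
  · intro j _ hj
    rw [map_map_eq_map_comp, biproduct.ι_π_ne A (Ne.symm hj)]
    exact complexBetti_map_zero_hom_apply two_ne_zero (h j)
  · exact fun hi ↦ absurd (Finset.mem_univ i) hi

/-- **`Σⱼ πⱼ^* hⱼ` determines every `hᵢ`.** [cite: LangeBirkenhake1992, §5.3] [cite: Milne1999LefschetzClasses, §1 p. 643] -/
theorem sumPolarizationClass_inj {m : ℕ} (A : Fin m → AbelianVariety ℂ) {h h' : ∀ i, complexBetti (A i).X 2} :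
    sumPolarizationClass A h = sumPolarizationClass A h' ↔ h = h' := by
  refine ⟨fun e ↦ funext fun i ↦ ?_, fun e ↦ by rw [e]⟩
  rw [← complexBetti_map_biproductι_sumPolarizationClass A h i, e, complexBetti_map_biproductι_sumPolarizationClass]

variable (A : AbelianVariety ℂ) (h : complexBetti A.X 2)

/-- **`ι^* h^{(a+1)} = h` for every coordinate inclusion `ι : A ⟶ A^{a+1}`** (`ι ≫ pr_s = 𝟙`, `ι ≫ pr_r = 0` for
`r ≠ s`): by `h^{(a+1)} = Σᵣ prᵣ^* h` (`powPolarizationClass_eq_sum`) and `0^* = 0` in positive degree.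
[cite: LangeBirkenhake1992, §5.3] [cite: Milne1999LefschetzClasses, §1 p. 643] [cite: MumfordAV1970, §19] -/
theorem complexBetti_map_powPolarizationClass_of_comp_powProj (a : ℕ) (s : Fin (a + 1)) (ι : A ⟶ A.powSucc a)
    (hs : ι ≫ powProj A a s = 𝟙 A) (hne : ∀ r, r ≠ s → ι ≫ powProj A a r = 0) :
    complexBetti.map ι.hom.hom.hom 2 (powPolarizationClass A h a) = h := by
  rw [powPolarizationClass_eq_sum, map_sum, Finset.sum_eq_single s]
  · rw [map_map_eq_map_comp, hs]
    change complexBetti.map (𝟙 A.X) 2 h = h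
    rw [complexBetti.map_id]
    rfl
  · intro r _ hr
    rw [map_map_eq_map_comp, hne r hr]
    exact complexBetti_map_zero_hom_apply two_ne_zero h
  · exact fun hs' ↦ absurd (Finset.mem_univ s) hs'

/-- **The `s`-th coordinate inclusion `(0, …, 𝟙, …, 0) : A ⟶ A^{a+1}` restricts `h^{(a+1)}` to `h`.**
[cite: LangeBirkenhake1992, §5.3] [cite: Milne1999LefschetzClasses, §1 p. 643] [cite: MumfordAV1970, §19] -/
theorem complexBetti_map_powLift_single_powPolarizationClass (a : ℕ) (s : Fin (a + 1)) :
    complexBetti.map (powLift a fun r ↦ if r = s then 𝟙 A else (0 : A ⟶ A)).hom.hom.hom 2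
      (powPolarizationClass A h a) = h :=
  complexBetti_map_powPolarizationClass_of_comp_powProj A h a s _ (by rw [powLift_powProj, if_pos rfl])
    fun r hr ↦ by rw [powLift_powProj, if_neg hr]

/-- **`h^{(a+1)}` determines `h`.** [cite: LangeBirkenhake1992, §5.3] [cite: Milne1999LefschetzClasses, §1 p. 643] -/
theorem powPolarizationClass_inj (a : ℕ) {h h' : complexBetti A.X 2} :
    powPolarizationClass A h a = powPolarizationClass A h' a ↔ h = h' := by
  refine ⟨fun e ↦ ?_, fun e ↦ by rw [e]⟩
  rw [← complexBetti_map_powLift_single_powPolarizationClass A h a 0, e,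
    complexBetti_map_powLift_single_powPolarizationClass]

end Inclusions

end Literature.AlgebraicGeometry.Milne1999

end
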